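import Literature.NumberTheory.EllipticCurves.GrossPointsKolyvaginDerivative
import Literature.NumberTheory.EllipticCurves.QuadOrderPicardKernelGenerators
import HarnessLib

/-!
# Kolyvagin choices exist: generators `σ_ℓ` of `G_ℓ = ker(Pic(𝒪_c) → Pic(𝒪_{c/ℓ}))` and a
# transversal `𝒢`, for `c` a squarefree product of primes inert in `K` (Gross 1991 §3; W. Zhang 2014 §3.7)

Topic `NumberTheory/EllipticCurves` (sequel of `GrossPointsKolyvaginDerivative.lean` and
`QuadOrderPicardCoprimeCyclic.lean`). Namespace
`Literature.NumberTheory.EllipticCurves.GrossKolyvaginChoice`. THEOREMS ONLY (no definition, no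
named fact, no `sorry`, no instance).

The tree's structure `GrossKolyvaginChoice K c` (`GrossPointsKolyvaginDerivative`) RECORDS the
choices of Gross 1991 §3 / W. Zhang 2014 §3.7 at a conductor `c`: for each prime `ℓ ∣ c` a class
`σ ℓ ∈ Pic(𝒪_c)` restricting trivially to conductor `c/ℓ` (`σ_mem`) such that every such class is a
power of it (`σ_gen`) — "`G_ℓ ≃ 𝔽_λ^×/𝔽_ℓ^×` are cyclic of order `ℓ + 1`. Let `σ_ℓ` be a fixed
generator of `G_ℓ`" — and a transversal `𝒢` of `Pic(𝒪_c)` modulo `⟨σ ℓ⟩_ℓ`. This file proves that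
such choices EXIST when `K` is quadratic and `c` is a squarefree product of primes `ℓ` with `ℓ𝓞_K`
prime (inert): `nonempty_of_squarefree` — from the cyclicity of the kernels
(`QuadOrderTower.exists_generator_ker_picRes`) and the finiteness of `Pic(𝒪_c)`
(`QuadOrderTower.finite_classGroup`, feeding the tree's `GrossKolyvaginChoice.ofGenerators`);
and that the generators can be taken of order EXACTLY `ℓ + 1` when the units of the orders
`𝒪_{c/ℓ}` are `±1` (`exists_forall_orderOf_σ_eq`; for `K` imaginary quadratic this only asks the units
of `𝓞_K` to be `±1`, i.e. `d_K < −4`: `exists_forall_orderOf_σ_eq_of_units_one`); and that the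
choices at all levels `n ∣ N` can be made with ONE `σ_q` — the generators at level `n` being the
restrictions `picRes_{N→n} (σ q)` of those at level `N` (`exists_σ_eq_picRes`,
`exists_σ_eq_picRes_orderOf`, from `QuadOrderTower.picRes_generator_of_dvd`: Gross's "`G_ℓ` is the
subgroup [of `G_n`] fixing `K_{n/ℓ}` … `σ_ℓ` a fixed generator", the same at every level).

Not here: anything about Gross points, norm relations or `L`-values; the identification of
`Pic(𝒪_c)` with `Gal(K[c]/K)`.

## References
* [GrossLMS1991] B. H. Gross, *Kolyvagin's work on modular elliptic curves*, LMS Lecture Notes 153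
  (1991), §3 before (3.5) (held `book:editornd-l-functions-arithmetic`, p0217).
* [WZhang2014] W. Zhang, *Selmer groups and the indivisibility of Heegner points*, Camb. J. Math. 2
  (2014), §3.7 (PDF p. 212: `G_ℓ`, `σ_ℓ`, `𝒢`).
* [Cox2013] D. A. Cox, *Primes of the form x² + ny²*, 2nd ed. (2013), §7.D (7.27).
-/

noncomputable section

open NumberField Module

namespace Literature.NumberTheory.EllipticCurves

namespace GrossKolyvaginChoice

universe u

variable {K : Type u} [Field K] [NumberField K] {c : ℕ}

/-- For `c` squarefree and a prime `ℓ ∣ c`: `c = (c/ℓ)·ℓ` with `ℓ ∤ c/ℓ` and `c/ℓ ≥ 1`. [cite: WZhang2014, §3.7 (n ∈ Λ squarefree)] -/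
theorem div_mul_of_squarefree (hc : Squarefree c) {ℓ : ℕ} (hℓ : ℓ ∈ c.primeFactors) :
    c = c / ℓ * ℓ ∧ ¬ ℓ ∣ c / ℓ ∧ c / ℓ ≠ 0 := by
  have hℓp : ℓ.Prime := Nat.prime_of_mem_primeFactors hℓ
  have hℓc : ℓ ∣ c := Nat.dvd_of_mem_primeFactors hℓ
  have hd : c = c / ℓ * ℓ := (Nat.div_mul_cancel hℓc).symm
  refine ⟨hd, fun h => ?_, ?_⟩
  · obtain ⟨k, hk⟩ := h
    have hsq : ℓ * ℓ ∣ c := ⟨k, by rw [hd, hk]; ring⟩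
    have := hc ℓ hsq
    rw [Nat.isUnit_iff] at this
    exact hℓp.one_lt.ne' this
  · exact (Nat.div_pos (Nat.le_of_dvd (Nat.pos_of_ne_zero hc.ne_zero) hℓc) hℓp.pos).ne'

/-- **Kolyvagin choices exist** (`K` quadratic, `c` squarefree, every prime `ℓ ∣ c` with `ℓ𝓞_K`
prime): each `G_ℓ = ker(Pic(𝒪_c) → Pic(𝒪_{c/ℓ}))` has a generator
(`QuadOrderTower.exists_generator_ker_picRes`) and `Pic(𝒪_c)` is finite
(`QuadOrderTower.finite_classGroup`), so a transversal `𝒢` exists (`ofGenerators`). Gross 1991 §3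
("Let `σ_ℓ` be a fixed generator of `G_ℓ`"), W. Zhang 2014 §3.7 ("Fix a set `𝒢` of representatives").
[cite: GrossLMS1991, §3 (G_ℓ cyclic, generator σ_ℓ)] [cite: WZhang2014, §3.7 (PDF p. 212)] -/
theorem nonempty_of_squarefree (h2 : Module.finrank ℚ K = 2) (hc : Squarefree c)
    (hin : ∀ ℓ ∈ c.primeFactors, (Ideal.span {(ℓ : 𝓞 K)}).IsPrime) :
    Nonempty (GrossKolyvaginChoice K c) := by
  classical
  haveI : NeZero c := ⟨hc.ne_zero⟩
  haveI := QuadOrderTower.finite_classGroup (K := K) c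
  have hgen : ∀ ℓ (hℓ : ℓ ∈ c.primeFactors), ∃ σ : ClassGroup (quadOrder K c),
      picRes K (Nat.div_dvd_of_dvd (Nat.dvd_of_mem_primeFactors hℓ)) σ = 1 ∧
        ∀ τ : ClassGroup (quadOrder K c),
          picRes K (Nat.div_dvd_of_dvd (Nat.dvd_of_mem_primeFactors hℓ)) τ = 1 →
            τ ∈ Subgroup.zpowers σ := by
    intro ℓ hℓ
    obtain ⟨hd, hndvd, hne⟩ := div_mul_of_squarefree hc hℓ
    haveI : Fact ℓ.Prime := ⟨Nat.prime_of_mem_primeFactors hℓ⟩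
    haveI : NeZero (c / ℓ) := ⟨hne⟩
    exact QuadOrderTower.exists_generator_ker_picRes (K := K) h2 hd hndvd (hin ℓ hℓ)
  choose σ hσ using hgen
  refine ⟨ofGenerators K (fun ℓ => if h : ℓ ∈ c.primeFactors then σ ℓ h else 1) ?_ ?_⟩
  · intro ℓ hℓ
    simp only [dif_pos hℓ]
    exact (hσ ℓ hℓ).1
  · intro ℓ hℓ τ hτ
    simp only [dif_pos hℓ]
    exact (hσ ℓ hℓ).2 τ hτ

/-- **Kolyvagin choices with generators of order exactly `ℓ + 1`**: if moreover the units of each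
order `𝒪_{c/ℓ}` are `±1`, there is a choice with `orderOf (σ ℓ) = ℓ + 1` for every prime `ℓ ∣ c`
(Gross 1991 §3: `G_ℓ` cyclic of order `ℓ + 1`; `QuadOrderTower.orderOf_eq_of_generator`).
[cite: GrossLMS1991, §3 (G_ℓ ≃ 𝔽_λ^×/𝔽_ℓ^× cyclic of order ℓ + 1)] -/
theorem exists_forall_orderOf_σ_eq (h2 : Module.finrank ℚ K = 2) (hc : Squarefree c)
    (hin : ∀ ℓ ∈ c.primeFactors, (Ideal.span {(ℓ : 𝓞 K)}).IsPrime)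
    (hunits : ∀ ℓ ∈ c.primeFactors, ∀ u : (quadOrder K (c / ℓ))ˣ,
      ((u : quadOrder K (c / ℓ)) : K) = 1 ∨ ((u : quadOrder K (c / ℓ)) : K) = -1) :
    ∃ ch : GrossKolyvaginChoice K c, ∀ ℓ ∈ c.primeFactors, orderOf (ch.σ ℓ) = ℓ + 1 := by
  classical
  haveI : NeZero c := ⟨hc.ne_zero⟩
  haveI := QuadOrderTower.finite_classGroup (K := K) c
  obtain ⟨b, hb⟩ := Literature.NumberTheory.QuadraticFields.Quadratic.exists_basis_zero_eq_one (K := K) h2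
  have hgen : ∀ ℓ (hℓ : ℓ ∈ c.primeFactors), ∃ σ : ClassGroup (quadOrder K c),
      picRes K (Nat.div_dvd_of_dvd (Nat.dvd_of_mem_primeFactors hℓ)) σ = 1 ∧
        (∀ τ : ClassGroup (quadOrder K c),
          picRes K (Nat.div_dvd_of_dvd (Nat.dvd_of_mem_primeFactors hℓ)) τ = 1 →
            τ ∈ Subgroup.zpowers σ) ∧ orderOf σ = ℓ + 1 := by
    intro ℓ hℓ
    obtain ⟨hd, hndvd, hne⟩ := div_mul_of_squarefree hc hℓ
    haveI : Fact ℓ.Prime := ⟨Nat.prime_of_mem_primeFactors hℓ⟩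
    haveI : NeZero (c / ℓ) := ⟨hne⟩
    obtain ⟨σ, hσ, hσgen⟩ := QuadOrderTower.exists_generator_ker_picRes (K := K) h2 hd hndvd (hin ℓ hℓ)
    exact ⟨σ, hσ, hσgen, QuadOrderTower.orderOf_eq_of_generator b hb (hunits ℓ hℓ) hd hndvd
      (hin ℓ hℓ) hσ hσgen⟩
  choose σ hσ using hgen
  refine ⟨ofGenerators K (fun ℓ => if h : ℓ ∈ c.primeFactors then σ ℓ h else 1) ?_ ?_, ?_⟩
  · intro ℓ hℓ
    simp only [dif_pos hℓ]
    exact (hσ ℓ hℓ).1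
  · intro ℓ hℓ τ hτ
    simp only [dif_pos hℓ]
    exact (hσ ℓ hℓ).2.1 τ hτ
  · intro ℓ hℓ
    simp only [ofGenerators_σ, dif_pos hℓ]
    exact (hσ ℓ hℓ).2.2

/-- **Imaginary quadratic `K` whose units are `±1`** (hypothesis `hunits1` on `𝒪_1 = 𝓞_K`, i.e.
`d_K < −4`; e.g. `CaiShuTian2014.coe_units_quadOrder_eq_one_or_eq_neg_one_of_discr_lt … 1`; the orders
`𝒪_n`, `n ≥ 2`, always have units `±1`, `QuadOrderTower.coe_units_quadOrder_eq_one_or_eq_neg_one`):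
for `c` a squarefree product of inert primes there is a Kolyvagin choice all of whose generators
`σ ℓ` have order `ℓ + 1`. [cite: GrossLMS1991, §3 (G_ℓ cyclic of order ℓ + 1, generator σ_ℓ)] -/
theorem exists_forall_orderOf_σ_eq_of_units_one (hK : IsImaginaryQuadratic K) (hc : Squarefree c)
    (hin : ∀ ℓ ∈ c.primeFactors, (Ideal.span {(ℓ : 𝓞 K)}).IsPrime)
    (hunits1 : ∀ u : (quadOrder K 1)ˣ, ((u : quadOrder K 1) : K) = 1 ∨ ((u : quadOrder K 1) : K) = -1) :
    ∃ ch : GrossKolyvaginChoice K c, ∀ ℓ ∈ c.primeFactors, orderOf (ch.σ ℓ) = ℓ + 1 := by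
  refine exists_forall_orderOf_σ_eq hK.1 hc hin fun ℓ hℓ => ?_
  by_cases h1 : c / ℓ = 1
  · rw [h1]; exact hunits1
  · have hne := (div_mul_of_squarefree hc hℓ).2.2
    exact QuadOrderTower.coe_units_quadOrder_eq_one_or_eq_neg_one hK
      (Nat.lt_of_le_of_ne (Nat.one_le_iff_ne_zero.mpr hne) (Ne.symm h1))

/-! ### One `σ_q` for all levels `n ∣ N` -/

/-- **Kolyvagin choices at every level `n ∣ N` with the SAME generators**: for `N` square-free with
all prime factors inert in the quadratic field `K` and a Kolyvagin choice `chN` at level `N`, at every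
level `n ∣ N` there is a Kolyvagin choice whose generator at each prime `q ∣ n` is the restriction
`picRes_{N→n} (chN.σ q)` (`QuadOrderTower.picRes_generator_of_dvd`) — Gross 1991 §3: `σ_ℓ` "a fixed
generator of `G_ℓ`", `G_ℓ ⊆ G_n` "the subgroup fixing `K_{n/ℓ}`", one element for all levels.
[cite: GrossLMS1991, §3 (G_n ≃ ∏ G_ℓ, G_ℓ fixing K_{n/ℓ}; σ_ℓ a fixed generator)] -/
theorem exists_σ_eq_picRes (h2 : Module.finrank ℚ K = 2) {N : ℕ} (hN : Squarefree N)
    (hin : ∀ q ∈ N.primeFactors, (Ideal.span {(q : 𝓞 K)}).IsPrime) (chN : GrossKolyvaginChoice K N)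
    {n : ℕ} (hn : n ∣ N) :
    ∃ ch : GrossKolyvaginChoice K n, ∀ q ∈ n.primeFactors, ch.σ q = picRes K hn (chN.σ q) := by
  classical
  haveI : NeZero n := ⟨fun h0 => hN.ne_zero (Nat.eq_zero_of_zero_dvd (h0 ▸ hn))⟩
  haveI := QuadOrderTower.finite_classGroup (K := K) n
  refine ⟨ofGenerators K (fun q => picRes K hn (chN.σ q)) (fun q hq => ?_) (fun q hq τ hτ => ?_),
    fun q _ => rfl⟩
  · exact (QuadOrderTower.picRes_generator_of_dvd h2 N hN hin hn hq
      (chN.σ_mem q (Nat.primeFactors_mono hn hN.ne_zero hq))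
      (chN.σ_gen q (Nat.primeFactors_mono hn hN.ne_zero hq))).1
  · exact (QuadOrderTower.picRes_generator_of_dvd h2 N hN hin hn hq
      (chN.σ_mem q (Nat.primeFactors_mono hn hN.ne_zero hq))
      (chN.σ_gen q (Nat.primeFactors_mono hn hN.ne_zero hq))).2 τ hτ

/-- **… and all these generators have order `q + 1`** when `𝓞_K^× = {±1}` (then every `𝒪_m^× = {±1}`,
`QuadOrderTower.coe_units_eq_of_units_one`; `QuadOrderTower.orderOf_eq_of_generator`).
[cite: GrossLMS1991, §3 (G_ℓ ≃ 𝔽_λ^×/𝔽_ℓ^× cyclic of order ℓ + 1 at every level)] -/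
theorem exists_σ_eq_picRes_orderOf (h2 : Module.finrank ℚ K = 2) {N : ℕ} (hN : Squarefree N)
    (hin : ∀ q ∈ N.primeFactors, (Ideal.span {(q : 𝓞 K)}).IsPrime)
    (hunits1 : ∀ u : (quadOrder K 1)ˣ, ((u : quadOrder K 1) : K) = 1 ∨ ((u : quadOrder K 1) : K) = -1)
    (chN : GrossKolyvaginChoice K N) {n : ℕ} (hn : n ∣ N) :
    ∃ ch : GrossKolyvaginChoice K n, (∀ q ∈ n.primeFactors, ch.σ q = picRes K hn (chN.σ q)) ∧
      ∀ q ∈ n.primeFactors, orderOf (ch.σ q) = q + 1 := by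
  obtain ⟨ch, hch⟩ := exists_σ_eq_picRes h2 hN hin chN hn
  obtain ⟨b, hb⟩ := Literature.NumberTheory.QuadraticFields.Quadratic.exists_basis_zero_eq_one (K := K) h2
  have hsq : Squarefree n := hN.squarefree_of_dvd hn
  haveI : NeZero n := ⟨hsq.ne_zero⟩
  refine ⟨ch, hch, fun q hq => ?_⟩
  obtain ⟨hd, hndvd, hne⟩ := div_mul_of_squarefree hsq hq
  haveI : Fact q.Prime := ⟨Nat.prime_of_mem_primeFactors hq⟩
  haveI : NeZero (n / q) := ⟨hne⟩
  exact QuadOrderTower.orderOf_eq_of_generator b hb (QuadOrderTower.coe_units_eq_of_units_one hunits1)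
    hd hndvd (hin q (Nat.primeFactors_mono hn hN.ne_zero hq)) (ch.σ_mem q hq) (ch.σ_gen q hq)

/-- **The transversal of a Kolyvagin choice is a transversal of `Pic(𝒪_N)/G_N`,
`G_N = ker(Pic(𝒪_N) → Pic(𝒪_1))`** (square-free inert `N`;
`QuadOrderTower.closure_range_eq_ker_picRes_one`). [cite: WZhang2014, §3.7 (PDF p. 212)] -/
theorem reps_transversal_ker (h2 : Module.finrank ℚ K = 2) {N : ℕ} (hN : Squarefree N)
    (hin : ∀ q ∈ N.primeFactors, (Ideal.span {(q : 𝓞 K)}).IsPrime) (chN : GrossKolyvaginChoice K N)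
    (τ : ClassGroup (quadOrder K N)) : ∃! s, s ∈ chN.reps ∧ s⁻¹ * τ ∈ (picRes K (one_dvd N)).ker := by
  rw [← QuadOrderTower.closure_range_eq_ker_picRes_one h2 N hN hin chN.σ chN.σ_mem chN.σ_gen]
  exact chN.reps_transversal τ

/-- **Fully compatible Kolyvagin choices at every level `n ∣ N`: the SAME `σ_q` AND the SAME `𝒢`**
(Gross 1991 §3 "`σ_ℓ` a fixed generator of `G_ℓ`" and §4 "We use the same set `S` to define `P_m`
for any `m ∣ n`"): given a choice `chN` at the square-free inert level `N` and `n ∣ N`, the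
restrictions `picRes_{N→n} (chN.σ q)` (`q ∣ n`) together with the image `picRes_{N→n}(𝒢)` form a
Kolyvagin choice at level `n` (`QuadOrderTower.picRes_generator_of_dvd`,
`QuadOrderTower.transversal_image_picRes`). [cite: GrossLMS1991, §3 (one σ_ℓ), §4 (4.1) (the same S for every m ∣ n)] -/
theorem exists_σ_eq_picRes_reps_eq (h2 : Module.finrank ℚ K = 2) {N : ℕ} (hN : Squarefree N)
    (hin : ∀ q ∈ N.primeFactors, (Ideal.span {(q : 𝓞 K)}).IsPrime) (chN : GrossKolyvaginChoice K N)
    {n : ℕ} (hn : n ∣ N) [DecidableEq (ClassGroup (quadOrder K n))] :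
    ∃ ch : GrossKolyvaginChoice K n, (∀ q ∈ n.primeFactors, ch.σ q = picRes K hn (chN.σ q)) ∧
      ch.reps = chN.reps.image (picRes K hn) := by
  haveI : NeZero N := ⟨hN.ne_zero⟩
  haveI : NeZero n := ⟨fun h0 => hN.ne_zero (Nat.eq_zero_of_zero_dvd (h0 ▸ hn))⟩
  have hsq : Squarefree n := hN.squarefree_of_dvd hn
  have hin' : ∀ q ∈ n.primeFactors, (Ideal.span {(q : 𝓞 K)}).IsPrime := fun q hq =>
    hin q (Nat.primeFactors_mono hn hN.ne_zero hq)
  have hmem : ∀ (q : ℕ) (hq : q ∈ n.primeFactors),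
      picRes K (Nat.div_dvd_of_dvd (Nat.dvd_of_mem_primeFactors hq)) (picRes K hn (chN.σ q)) = 1 :=
    fun q hq => (QuadOrderTower.picRes_generator_of_dvd h2 N hN hin hn hq
      (chN.σ_mem q (Nat.primeFactors_mono hn hN.ne_zero hq))
      (chN.σ_gen q (Nat.primeFactors_mono hn hN.ne_zero hq))).1
  have hgen : ∀ (q : ℕ) (hq : q ∈ n.primeFactors) (τ : ClassGroup (quadOrder K n)),
      picRes K (Nat.div_dvd_of_dvd (Nat.dvd_of_mem_primeFactors hq)) τ = 1 →
        τ ∈ Subgroup.zpowers (picRes K hn (chN.σ q)) :=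
    fun q hq => (QuadOrderTower.picRes_generator_of_dvd h2 N hN hin hn hq
      (chN.σ_mem q (Nat.primeFactors_mono hn hN.ne_zero hq))
      (chN.σ_gen q (Nat.primeFactors_mono hn hN.ne_zero hq))).2
  have hker : Subgroup.closure (Set.range fun q : n.primeFactors => picRes K hn (chN.σ q)) =
      (picRes K (one_dvd n)).ker :=
    QuadOrderTower.closure_range_eq_ker_picRes_one h2 n hsq hin' (fun q => picRes K hn (chN.σ q)) hmem hgen
  refine ⟨{ σ := fun q => picRes K hn (chN.σ q)
            σ_mem := hmem
            σ_gen := hgen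
            reps := chN.reps.image (picRes K hn)
            reps_transversal := fun τ => ?_ }, fun q _ => rfl, rfl⟩
  have ht := QuadOrderTower.transversal_image_picRes h2 N hN hin hn chN.reps
    (reps_transversal_ker h2 hN hin chN) τ
  rw [← hker] at ht
  exact ht

end GrossKolyvaginChoice

end Literature.NumberTheory.EllipticCurves

end
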